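import Mathlib
import Summits.KontsevichZagierPeriods.KontsevichZagierPeriods.Theorems.InverseLandauTateLiftingFubiniReduction

/-!
# `TateLifting` (stmt-KontsevichZagierPeriods-9129), line `Sketch` — the all-dimensional cylinder /
Fubini sector

Crux `Summit.KontsevichZagierPeriods.KontsevichZagierPeriods.Theses.InverseLandau.TateLifting`
(`ker KZ.eval ⊆ KZ.relations ⊔ closure T`, `T` = Tate fibres) is Conjecture-1-strength in general; the
line lands the SECTORS on which it is a theorem. After the dimension-≤-1 sectors
(`Theorems/InverseLandauTateLiftingDimOneSector.lean`, `…LowDimAlgSector.lean`) and the reduction file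
`Theorems/InverseLandauTateLiftingFubiniReduction.lean` (cylinder representations of every dimension and
polynomial cubes reduced to the low-dimensional generators by cubical Stokes moves; products through the
ideal structure of `KZProductIdeal`), this file states the first sector with generators of EVERY dimension:

* `fubiniLowDimKernel` — **the kernel form of Conjecture 1 on the subgroup of `KZ.FormalRep` generated by:
  all representations of dimension `0`; the dimension-one representations with integrand `p/q`,
  `p, q ∈ ℝ[x]` with real-algebraic coefficients; the CYLINDER representations `[(0,1)ⁿ⁺¹, P(z)/q(z₀)]`
  (`P ∈ K[z₀,…,z_n]`, `q ∈ K[x]`, `q ≠ 0` on `[0,1]`, `K = algebraicClosure ℚ ℝ`) of ALL dimensions; and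
  the Fubini products (`*` of `KZProduct`, either order) of any of these with a representation over `ℝ⁰`
  or a polynomial cube `[(0,1)ⁿ, P]` of any dimension**;
* `TateLifting_fubiniSector` — hence the crux holds on this sector;
* `kzPeriodConjecture_cubePoly` — **two polynomial cubes `[(0,1)ⁿ, P]`, `[(0,1)ᵐ, P′]` over `K` of ANY
  dimensions `n, m` with the same value are KZ-equivalent**;
* `kzPeriodConjecture_cylinder` — the same for two cylinder representations of any dimensions;
* `kzPeriodConjecture_cubePoly_prod_dimOneAlg` — the same for Fubini products of a polynomial cube of any
  dimension with an algebraic-coefficient dimension-one representation;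
* `cylinder_mem_relations_of_value_eq_zero`, `tateFamilyKernel_cylinder`,
  `tateFamilyKernel_of_cylinderDenominator` — **a sector of the route's OTHER crux `TateFamilyKernel`
  (stmt-KontsevichZagierPeriods-9130) in every dimension**: the fibre at a real-algebraic parameter of a
  rational family `P(z,ϖ)/Q(z₀,ϖ)` whose denominator involves only one cube variable, with vanishing
  integral, is a relation (no Tate condition, no identical vanishing needed).

The values of all these representations lie in the Baker module (`K`-span of `1`, `π` and logarithms of
algebraic numbers); the only transcendence input is Baker's theorem, through the landed dimension-one kernel.

References: M. Kontsevich, D. Zagier, *Periods* (2001), §§1.1–1.2, §4.1 ("the product of integrals is again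
an integral (Fubini formula)"); A. Baker, *Transcendental Number Theory* (1975), Thm 2.1.
-/

noncomputable section

namespace Summit.KontsevichZagierPeriods.InverseLandau

open MeasureTheory Set
open Literature.NumberTheory.Transcendental

/-- **THE FUBINI SECTOR (kernel form).** Every vanishing `ℤ`-combination of: representations over `ℝ⁰`;
dimension-one representations with algebraic-coefficient integrand `p/q`; cylinder representations
`[(0,1)ⁿ⁺¹, P(z)/q(z₀)]` over `K = algebraicClosure ℚ ℝ` of any dimension; and Fubini products (either order)
of any of these with a representation over `ℝ⁰` or a polynomial cube of any dimension — is a relation of the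
Kontsevich–Zagier calculus. Proof: flatten the combination, replace every generator by its low-dimensional
representative (`Fubini.reduce`), transport the vanishing of `eval` (soundness `KZ.relations_le_ker_eval_holds`),
and apply the landed low-dimensional kernel `kzKernelConjecture_lowDimAlg`. [cite: KontsevichZagier2001, §1.2] -/
theorem fubiniLowDimKernel :
    ∀ c ∈ AddSubgroup.closure
        ({d : KZ.FormalRep | (∃ r : KZ.IntegralRep 0, d = KZ.of r) ∨
            ∃ (r : KZ.IntegralRep 1) (p q : Polynomial ℝ), (∀ i, IsAlgebraic ℚ (p.coeff i)) ∧
              (∀ i, IsAlgebraic ℚ (q.coeff i)) ∧ (∀ x ∈ r.domain, q.eval (x 0) ≠ 0) ∧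
              Set.EqOn r.integrand (fun x => p.eval (x 0) / q.eval (x 0)) r.domain ∧ d = KZ.of r} ∪
          {d : KZ.FormalRep | ∃ (n : ℕ) (P : MvPolynomial (Fin (n + 1)) (algebraicClosure ℚ ℝ))
              (q : Polynomial (algebraicClosure ℚ ℝ)) (r : KZ.IntegralRep (n + 1)),
            (∀ t ∈ Set.Icc (0 : ℝ) 1, Polynomial.aeval t q ≠ 0) ∧
            r.domain = Set.pi Set.univ (fun _ => Set.Ioo (0 : ℝ) 1) ∧
            Set.EqOn r.integrand (fun z => MvPolynomial.aeval z P / Polynomial.aeval (z 0) q) r.domain ∧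
            d = KZ.of r} ∪
          {d : KZ.FormalRep | ∃ b ∈ {d : KZ.FormalRep | (∃ r : KZ.IntegralRep 0, d = KZ.of r) ∨
              ∃ (n : ℕ) (P : MvPolynomial (Fin n) (algebraicClosure ℚ ℝ)) (r : KZ.IntegralRep n),
                r.domain = Set.pi Set.univ (fun _ => Set.Ioo (0 : ℝ) 1) ∧
                Set.EqOn r.integrand (fun z => MvPolynomial.aeval z P) r.domain ∧ d = KZ.of r},
            ∃ g ∈ ({d : KZ.FormalRep | (∃ r : KZ.IntegralRep 0, d = KZ.of r) ∨
                ∃ (r : KZ.IntegralRep 1) (p q : Polynomial ℝ), (∀ i, IsAlgebraic ℚ (p.coeff i)) ∧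
                  (∀ i, IsAlgebraic ℚ (q.coeff i)) ∧ (∀ x ∈ r.domain, q.eval (x 0) ≠ 0) ∧
                  Set.EqOn r.integrand (fun x => p.eval (x 0) / q.eval (x 0)) r.domain ∧ d = KZ.of r} ∪
              {d : KZ.FormalRep | ∃ (n : ℕ) (P : MvPolynomial (Fin (n + 1)) (algebraicClosure ℚ ℝ))
                  (q : Polynomial (algebraicClosure ℚ ℝ)) (r : KZ.IntegralRep (n + 1)),
                (∀ t ∈ Set.Icc (0 : ℝ) 1, Polynomial.aeval t q ≠ 0) ∧
                r.domain = Set.pi Set.univ (fun _ => Set.Ioo (0 : ℝ) 1) ∧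
                Set.EqOn r.integrand (fun z => MvPolynomial.aeval z P / Polynomial.aeval (z 0) q)
                  r.domain ∧ d = KZ.of r}),
            d = b * g ∨ d = g * b}),
      KZ.eval c = 0 → c ∈ KZ.relations := by
  intro c hc hev
  classical
  rw [← Submodule.span_int_eq_addSubgroupClosure, Submodule.mem_toAddSubgroup,
    Submodule.mem_span_set'] at hc
  obtain ⟨k, f, g, rfl⟩ := hc
  choose ℓ hℓ hrel using fun i => Fubini.reduce (g i) (g i).2
  have hdiff : ∑ i, f i • ((g i : KZ.FormalRep)) - ∑ i, f i • ℓ i ∈ KZ.relations := by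
    rw [← Finset.sum_sub_distrib]
    refine sum_mem fun i _ => ?_
    rw [← smul_sub]
    exact KZ.relations.zsmul_mem (hrel i) _
  have hmem : ∑ i, f i • ℓ i ∈ AddSubgroup.closure
      {d : KZ.FormalRep | (∃ r : KZ.IntegralRep 0, d = KZ.of r) ∨
        ∃ (r : KZ.IntegralRep 1) (p q : Polynomial ℝ), (∀ i, IsAlgebraic ℚ (p.coeff i)) ∧
          (∀ i, IsAlgebraic ℚ (q.coeff i)) ∧ (∀ x ∈ r.domain, q.eval (x 0) ≠ 0) ∧
          Set.EqOn r.integrand (fun x => p.eval (x 0) / q.eval (x 0)) r.domain ∧ d = KZ.of r} :=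
    sum_mem fun i _ => AddSubgroup.zsmul_mem _ (hℓ i) _
  have hev' : KZ.eval (∑ i, f i • ℓ i) = 0 := by
    have h0 := KZ.relations_le_ker_eval_holds hdiff
    rw [AddMonoidHom.mem_ker, map_sub, hev, zero_sub, neg_eq_zero] at h0
    exact h0
  have hker := kzKernelConjecture_lowDimAlg _ hmem hev'
  have h := KZ.relations.add_mem hdiff hker
  rwa [sub_add_cancel] at h

/-- **The crux on the Fubini sector**: every vanishing `ℤ`-combination of Fubini generators lies in
`KZ.relations ⊔ closure T` (in fact in `KZ.relations`). [cite: KontsevichZagier2001, §1.2] -/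
theorem TateLifting_fubiniSector :
    ∀ c ∈ AddSubgroup.closure
        ({d : KZ.FormalRep | (∃ r : KZ.IntegralRep 0, d = KZ.of r) ∨
            ∃ (r : KZ.IntegralRep 1) (p q : Polynomial ℝ), (∀ i, IsAlgebraic ℚ (p.coeff i)) ∧
              (∀ i, IsAlgebraic ℚ (q.coeff i)) ∧ (∀ x ∈ r.domain, q.eval (x 0) ≠ 0) ∧
              Set.EqOn r.integrand (fun x => p.eval (x 0) / q.eval (x 0)) r.domain ∧ d = KZ.of r} ∪
          {d : KZ.FormalRep | ∃ (n : ℕ) (P : MvPolynomial (Fin (n + 1)) (algebraicClosure ℚ ℝ))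
              (q : Polynomial (algebraicClosure ℚ ℝ)) (r : KZ.IntegralRep (n + 1)),
            (∀ t ∈ Set.Icc (0 : ℝ) 1, Polynomial.aeval t q ≠ 0) ∧
            r.domain = Set.pi Set.univ (fun _ => Set.Ioo (0 : ℝ) 1) ∧
            Set.EqOn r.integrand (fun z => MvPolynomial.aeval z P / Polynomial.aeval (z 0) q) r.domain ∧
            d = KZ.of r} ∪
          {d : KZ.FormalRep | ∃ b ∈ {d : KZ.FormalRep | (∃ r : KZ.IntegralRep 0, d = KZ.of r) ∨
              ∃ (n : ℕ) (P : MvPolynomial (Fin n) (algebraicClosure ℚ ℝ)) (r : KZ.IntegralRep n),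
                r.domain = Set.pi Set.univ (fun _ => Set.Ioo (0 : ℝ) 1) ∧
                Set.EqOn r.integrand (fun z => MvPolynomial.aeval z P) r.domain ∧ d = KZ.of r},
            ∃ g ∈ ({d : KZ.FormalRep | (∃ r : KZ.IntegralRep 0, d = KZ.of r) ∨
                ∃ (r : KZ.IntegralRep 1) (p q : Polynomial ℝ), (∀ i, IsAlgebraic ℚ (p.coeff i)) ∧
                  (∀ i, IsAlgebraic ℚ (q.coeff i)) ∧ (∀ x ∈ r.domain, q.eval (x 0) ≠ 0) ∧
                  Set.EqOn r.integrand (fun x => p.eval (x 0) / q.eval (x 0)) r.domain ∧ d = KZ.of r} ∪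
              {d : KZ.FormalRep | ∃ (n : ℕ) (P : MvPolynomial (Fin (n + 1)) (algebraicClosure ℚ ℝ))
                  (q : Polynomial (algebraicClosure ℚ ℝ)) (r : KZ.IntegralRep (n + 1)),
                (∀ t ∈ Set.Icc (0 : ℝ) 1, Polynomial.aeval t q ≠ 0) ∧
                r.domain = Set.pi Set.univ (fun _ => Set.Ioo (0 : ℝ) 1) ∧
                Set.EqOn r.integrand (fun z => MvPolynomial.aeval z P / Polynomial.aeval (z 0) q)
                  r.domain ∧ d = KZ.of r}),
            d = b * g ∨ d = g * b}),
      KZ.eval c = 0 → c ∈ KZ.relations ⊔ AddSubgroup.closure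
        {d : KZ.FormalRep | ∃ (n : ℕ) (P Q : MvPolynomial (Fin (n + 1)) ℚ) (ε ϖ₀ : ℝ)
            (r : KZ.IntegralRep n), 0 < ε ∧
          (∃ c₀ : ℚ, c₀ ≠ 0 ∧ ∀ z : Fin n → ℝ,
            MvPolynomial.aeval (Fin.snoc z (0 : ℝ) : Fin (n + 1) → ℝ) Q = (c₀ : ℝ)) ∧
          (∀ (z : Fin n → ℝ) (ϖ : ℝ), (∀ i, z i ∈ Set.Icc (0 : ℝ) 1) → ϖ ∈ Set.Ioo 0 ε →
            MvPolynomial.aeval (Fin.snoc z ϖ : Fin (n + 1) → ℝ) Q ≠ 0) ∧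
          (∀ ϖ ∈ Set.Ioo (0 : ℝ) ε, ∫ z in Set.pi Set.univ (fun _ : Fin n => Set.Ioo (0 : ℝ) 1),
            MvPolynomial.aeval (Fin.snoc z ϖ : Fin (n + 1) → ℝ) P /
              MvPolynomial.aeval (Fin.snoc z ϖ : Fin (n + 1) → ℝ) Q = 0) ∧
          IsAlgebraic ℚ ϖ₀ ∧ ϖ₀ ∈ Set.Ioo 0 ε ∧
          r.domain = Set.pi Set.univ (fun _ : Fin n => Set.Ioo (0 : ℝ) 1) ∧
          Set.EqOn r.integrand (fun z => MvPolynomial.aeval (Fin.snoc z ϖ₀ : Fin (n + 1) → ℝ) P /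
            MvPolynomial.aeval (Fin.snoc z ϖ₀ : Fin (n + 1) → ℝ) Q) r.domain ∧
          d = KZ.of r} :=
  fun c hc hev => AddSubgroup.mem_sup_left (fubiniLowDimKernel c hc hev)

/-- **KZ's Conjecture 1 for polynomial cubes of ANY dimensions.** Two honest representations `[(0,1)ⁿ, P]`,
`[(0,1)ᵐ, P′]` whose integrands are polynomials with real-algebraic coefficients (`P ∈ K[z₁..z_n]`,
`P′ ∈ K[z₁..z_m]`, `K = algebraicClosure ℚ ℝ`) on the open unit cubes of any two dimensions `n, m`, with the same
value, are KZ-equivalent (`n = 0`: a representation over `ℝ⁰`; `n ≥ 1`: a cylinder generator with `q = 1`).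
[cite: KontsevichZagier2001, §1.2] -/
theorem kzPeriodConjecture_cubePoly :
    ∀ (n m : ℕ) (r : KZ.IntegralRep n) (r' : KZ.IntegralRep m)
      (P : MvPolynomial (Fin n) (algebraicClosure ℚ ℝ)) (P' : MvPolynomial (Fin m) (algebraicClosure ℚ ℝ)),
      r.domain = Set.pi Set.univ (fun _ => Set.Ioo (0 : ℝ) 1) →
      Set.EqOn r.integrand (fun z => MvPolynomial.aeval z P) r.domain →
      r'.domain = Set.pi Set.univ (fun _ => Set.Ioo (0 : ℝ) 1) →
      Set.EqOn r'.integrand (fun z => MvPolynomial.aeval z P') r'.domain →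
      r.value = r'.value → KZ.Equivalent r r' := by
  -- polynomial cubes of every dimension are Fubini generators
  have hgen : ∀ {n : ℕ} (r : KZ.IntegralRep n) (P : MvPolynomial (Fin n) (algebraicClosure ℚ ℝ)),
      r.domain = Set.pi Set.univ (fun _ => Set.Ioo (0 : ℝ) 1) →
      Set.EqOn r.integrand (fun z => MvPolynomial.aeval z P) r.domain →
      KZ.of r ∈ ({d : KZ.FormalRep | (∃ r : KZ.IntegralRep 0, d = KZ.of r) ∨
            ∃ (r : KZ.IntegralRep 1) (p q : Polynomial ℝ), (∀ i, IsAlgebraic ℚ (p.coeff i)) ∧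
              (∀ i, IsAlgebraic ℚ (q.coeff i)) ∧ (∀ x ∈ r.domain, q.eval (x 0) ≠ 0) ∧
              Set.EqOn r.integrand (fun x => p.eval (x 0) / q.eval (x 0)) r.domain ∧ d = KZ.of r} ∪
          {d : KZ.FormalRep | ∃ (n : ℕ) (P : MvPolynomial (Fin (n + 1)) (algebraicClosure ℚ ℝ))
              (q : Polynomial (algebraicClosure ℚ ℝ)) (r : KZ.IntegralRep (n + 1)),
            (∀ t ∈ Set.Icc (0 : ℝ) 1, Polynomial.aeval t q ≠ 0) ∧
            r.domain = Set.pi Set.univ (fun _ => Set.Ioo (0 : ℝ) 1) ∧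
            Set.EqOn r.integrand (fun z => MvPolynomial.aeval z P / Polynomial.aeval (z 0) q) r.domain ∧
            d = KZ.of r} ∪
          {d : KZ.FormalRep | ∃ b ∈ {d : KZ.FormalRep | (∃ r : KZ.IntegralRep 0, d = KZ.of r) ∨
              ∃ (n : ℕ) (P : MvPolynomial (Fin n) (algebraicClosure ℚ ℝ)) (r : KZ.IntegralRep n),
                r.domain = Set.pi Set.univ (fun _ => Set.Ioo (0 : ℝ) 1) ∧
                Set.EqOn r.integrand (fun z => MvPolynomial.aeval z P) r.domain ∧ d = KZ.of r},
            ∃ g ∈ ({d : KZ.FormalRep | (∃ r : KZ.IntegralRep 0, d = KZ.of r) ∨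
                ∃ (r : KZ.IntegralRep 1) (p q : Polynomial ℝ), (∀ i, IsAlgebraic ℚ (p.coeff i)) ∧
                  (∀ i, IsAlgebraic ℚ (q.coeff i)) ∧ (∀ x ∈ r.domain, q.eval (x 0) ≠ 0) ∧
                  Set.EqOn r.integrand (fun x => p.eval (x 0) / q.eval (x 0)) r.domain ∧ d = KZ.of r} ∪
              {d : KZ.FormalRep | ∃ (n : ℕ) (P : MvPolynomial (Fin (n + 1)) (algebraicClosure ℚ ℝ))
                  (q : Polynomial (algebraicClosure ℚ ℝ)) (r : KZ.IntegralRep (n + 1)),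
                (∀ t ∈ Set.Icc (0 : ℝ) 1, Polynomial.aeval t q ≠ 0) ∧
                r.domain = Set.pi Set.univ (fun _ => Set.Ioo (0 : ℝ) 1) ∧
                Set.EqOn r.integrand (fun z => MvPolynomial.aeval z P / Polynomial.aeval (z 0) q)
                  r.domain ∧ d = KZ.of r}),
            d = b * g ∨ d = g * b}) := by
    intro n r P hd hi
    cases n with
    | zero => exact Or.inl (Or.inl (Or.inl ⟨r, rfl⟩))
    | succ k =>
      refine Or.inl (Or.inr ⟨k, P, 1, r, fun t _ => by rw [map_one]; exact one_ne_zero, hd,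
        fun z hz => ?_, rfl⟩)
      rw [hi hz]
      simp only [map_one, div_one]
  intro n m r r' P P' hd hi hd' hi' hv
  exact Fubini.equivalent_of_kernel fubiniLowDimKernel (hgen r P hd hi) (hgen r' P' hd' hi') hv

/-- **KZ's Conjecture 1 for cylinder representations of ANY dimensions**: two honest representations
`[(0,1)ⁿ⁺¹, P(z)/q(z₀)]`, `[(0,1)ᵐ⁺¹, P′(z)/q′(z₀)]` over `K` (`q, q′ ≠ 0` on `[0,1]`) with the same value are
KZ-equivalent. [cite: KontsevichZagier2001, §1.2] -/
theorem kzPeriodConjecture_cylinder :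
    ∀ (n m : ℕ) (r : KZ.IntegralRep (n + 1)) (r' : KZ.IntegralRep (m + 1))
      (P : MvPolynomial (Fin (n + 1)) (algebraicClosure ℚ ℝ)) (q : Polynomial (algebraicClosure ℚ ℝ))
      (P' : MvPolynomial (Fin (m + 1)) (algebraicClosure ℚ ℝ)) (q' : Polynomial (algebraicClosure ℚ ℝ)),
      (∀ t ∈ Set.Icc (0 : ℝ) 1, Polynomial.aeval t q ≠ 0) →
      r.domain = Set.pi Set.univ (fun _ => Set.Ioo (0 : ℝ) 1) →
      Set.EqOn r.integrand (fun z => MvPolynomial.aeval z P / Polynomial.aeval (z 0) q) r.domain →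
      (∀ t ∈ Set.Icc (0 : ℝ) 1, Polynomial.aeval t q' ≠ 0) →
      r'.domain = Set.pi Set.univ (fun _ => Set.Ioo (0 : ℝ) 1) →
      Set.EqOn r'.integrand (fun z => MvPolynomial.aeval z P' / Polynomial.aeval (z 0) q') r'.domain →
      r.value = r'.value → KZ.Equivalent r r' :=
  fun n m r r' P q P' q' hq hd hi hq' hd' hi' hv =>
    Fubini.equivalent_of_kernel fubiniLowDimKernel (Or.inl (Or.inr ⟨n, P, q, r, hq, hd, hi, rfl⟩))
      (Or.inl (Or.inr ⟨m, P', q', r', hq', hd', hi', rfl⟩)) hv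

/-- **KZ's Conjecture 1 for Fubini products**: the products `[(0,1)ⁿ, P] × [σ, p/q]` (`KZ.IntegralRep.prod`) of
a polynomial cube of any dimension with a dimension-one representation with algebraic-coefficient integrand —
two such products with the same value are KZ-equivalent. [cite: KontsevichZagier2001, §4.1] -/
theorem kzPeriodConjecture_cubePoly_prod_dimOneAlg :
    ∀ (n m : ℕ) (b : KZ.IntegralRep n) (b' : KZ.IntegralRep m)
      (P : MvPolynomial (Fin n) (algebraicClosure ℚ ℝ)) (P' : MvPolynomial (Fin m) (algebraicClosure ℚ ℝ))
      (s s' : KZ.IntegralRep 1) (p q p' q' : Polynomial ℝ),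
      b.domain = Set.pi Set.univ (fun _ => Set.Ioo (0 : ℝ) 1) →
      Set.EqOn b.integrand (fun z => MvPolynomial.aeval z P) b.domain →
      b'.domain = Set.pi Set.univ (fun _ => Set.Ioo (0 : ℝ) 1) →
      Set.EqOn b'.integrand (fun z => MvPolynomial.aeval z P') b'.domain →
      (∀ i, IsAlgebraic ℚ (p.coeff i)) → (∀ i, IsAlgebraic ℚ (q.coeff i)) →
      (∀ x ∈ s.domain, q.eval (x 0) ≠ 0) →
      Set.EqOn s.integrand (fun x => p.eval (x 0) / q.eval (x 0)) s.domain →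
      (∀ i, IsAlgebraic ℚ (p'.coeff i)) → (∀ i, IsAlgebraic ℚ (q'.coeff i)) →
      (∀ x ∈ s'.domain, q'.eval (x 0) ≠ 0) →
      Set.EqOn s'.integrand (fun x => p'.eval (x 0) / q'.eval (x 0)) s'.domain →
      (b.prod s).value = (b'.prod s').value → KZ.Equivalent (b.prod s) (b'.prod s') := by
  intro n m b b' P P' s s' p q p' q' hbd hbi hbd' hbi' hp hq hq0 hs hp' hq' hq0' hs' hv
  refine Fubini.equivalent_of_kernel fubiniLowDimKernel ?_ ?_ hv
  · rw [← KZ.of_mul_of]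
    exact Or.inr ⟨_, Or.inr ⟨n, P, b, hbd, hbi, rfl⟩, _,
      Or.inl (Or.inr ⟨s, p, q, hp, hq, hq0, hs, rfl⟩), Or.inl rfl⟩
  · rw [← KZ.of_mul_of]
    exact Or.inr ⟨_, Or.inr ⟨m, P', b', hbd', hbi', rfl⟩, _,
      Or.inl (Or.inr ⟨s', p', q', hp', hq', hq0', hs', rfl⟩), Or.inl rfl⟩

/-! ### Fibres of rational families with one-variable denominators (a sector of the crux `TateFamilyKernel`) -/

namespace Fubini

/-- Specialising the last variable of a rational-coefficient polynomial at a real algebraic number gives a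
polynomial over `K = algebraicClosure ℚ ℝ` with the expected evaluation. [folklore] -/
theorem exists_specLast {m : ℕ} (P : MvPolynomial (Fin (m + 1)) ℚ) {ϖ₀ : ℝ} (hϖ₀ : IsAlgebraic ℚ ϖ₀) :
    ∃ P₀ : MvPolynomial (Fin m) (algebraicClosure ℚ ℝ), ∀ z : Fin m → ℝ,
      (MvPolynomial.aeval z P₀ : ℝ) = MvPolynomial.aeval (Fin.snoc z ϖ₀ : Fin (m + 1) → ℝ) P := by
  set ϖK : algebraicClosure ℚ ℝ := ⟨ϖ₀, mem_algebraicClosure_iff.2 hϖ₀⟩ with hϖK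
  refine ⟨MvPolynomial.aeval (Fin.snoc (fun i => MvPolynomial.X i) (MvPolynomial.C ϖK) :
      Fin (m + 1) → MvPolynomial (Fin m) (algebraicClosure ℚ ℝ)) P, fun z => ?_⟩
  set φ : MvPolynomial (Fin m) (algebraicClosure ℚ ℝ) →ₐ[ℚ] ℝ :=
    (MvPolynomial.aeval z).restrictScalars ℚ with hφ
  have h1 : (MvPolynomial.aeval z (MvPolynomial.aeval (Fin.snoc (fun i => MvPolynomial.X i)
      (MvPolynomial.C ϖK) : Fin (m + 1) → MvPolynomial (Fin m) (algebraicClosure ℚ ℝ)) P) : ℝ) =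
      φ (MvPolynomial.aeval (Fin.snoc (fun i => MvPolynomial.X i) (MvPolynomial.C ϖK) :
        Fin (m + 1) → MvPolynomial (Fin m) (algebraicClosure ℚ ℝ)) P) := rfl
  have hfg : (fun i => φ ((Fin.snoc (fun i => MvPolynomial.X i) (MvPolynomial.C ϖK) :
      Fin (m + 1) → MvPolynomial (Fin m) (algebraicClosure ℚ ℝ)) i)) =
      (Fin.snoc z ϖ₀ : Fin (m + 1) → ℝ) := by
    funext i
    induction i using Fin.lastCases with
    | last => simp [hφ, hϖK, Fin.snoc_last]
    | cast j => simp [hφ, Fin.snoc_castSucc]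
  rw [h1, ← AlgHom.comp_apply, MvPolynomial.comp_aeval, hfg]

/-- Specialising the parameter of a two-variable rational-coefficient polynomial `Q(x, ϖ)` at a real algebraic
`ϖ₀` gives a one-variable polynomial over `K`. [folklore] -/
theorem exists_specParam (Q : MvPolynomial (Fin 2) ℚ) {ϖ₀ : ℝ} (hϖ₀ : IsAlgebraic ℚ ϖ₀) :
    ∃ q₀ : Polynomial (algebraicClosure ℚ ℝ), ∀ t : ℝ,
      (Polynomial.aeval t q₀ : ℝ) = MvPolynomial.aeval ![t, ϖ₀] Q := by
  set ϖK : algebraicClosure ℚ ℝ := ⟨ϖ₀, mem_algebraicClosure_iff.2 hϖ₀⟩ with hϖK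
  refine ⟨MvPolynomial.aeval (![Polynomial.X, Polynomial.C ϖK] :
      Fin 2 → Polynomial (algebraicClosure ℚ ℝ)) Q, fun t => ?_⟩
  set φ : Polynomial (algebraicClosure ℚ ℝ) →ₐ[ℚ] ℝ := (Polynomial.aeval t).restrictScalars ℚ with hφ
  have h1 : (Polynomial.aeval t (MvPolynomial.aeval (![Polynomial.X, Polynomial.C ϖK] :
      Fin 2 → Polynomial (algebraicClosure ℚ ℝ)) Q) : ℝ) =
      φ (MvPolynomial.aeval (![Polynomial.X, Polynomial.C ϖK] :
        Fin 2 → Polynomial (algebraicClosure ℚ ℝ)) Q) := rfl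
  have hfg : (fun i => φ ((![Polynomial.X, Polynomial.C ϖK] :
      Fin 2 → Polynomial (algebraicClosure ℚ ℝ)) i)) = ![t, ϖ₀] := by
    funext i
    fin_cases i
    · simp [hφ]
    · simp [hφ, hϖK]
  rw [h1, ← AlgHom.comp_apply, MvPolynomial.comp_aeval, hfg]


end Fubini

/-- **A cylinder representation with vanishing value is a relation**: `[(0,1)ⁿ⁺¹, P(z)/q(z₀)]` over `K` (`q ≠ 0`
on `[0,1]`) with `∫ = 0` lies in `KZ.relations`, in every dimension (the Fubini kernel on one generator).
[cite: KontsevichZagier2001, §1.2] -/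
theorem cylinder_mem_relations_of_value_eq_zero :
    ∀ (n : ℕ) (P : MvPolynomial (Fin (n + 1)) (algebraicClosure ℚ ℝ))
      (q : Polynomial (algebraicClosure ℚ ℝ)) (r : KZ.IntegralRep (n + 1)),
      (∀ t ∈ Set.Icc (0 : ℝ) 1, Polynomial.aeval t q ≠ 0) →
      r.domain = Set.pi Set.univ (fun _ => Set.Ioo (0 : ℝ) 1) →
      Set.EqOn r.integrand (fun z => MvPolynomial.aeval z P / Polynomial.aeval (z 0) q) r.domain →
      r.value = 0 → KZ.of r ∈ KZ.relations :=
  fun n P q r hq hd hi hv =>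
    fubiniLowDimKernel _ (AddSubgroup.subset_closure (Or.inl (Or.inr ⟨n, P, q, r, hq, hd, hi, rfl⟩)))
      (by rw [KZ.eval_of, hv])

/-- **Fibres of rational families whose denominator involves only `z₀` and the parameter.** For
`P ∈ ℚ[z₀,…,z_n,ϖ]`, `Q ∈ ℚ[x,ϖ]` and a real-algebraic `ϖ₀` with `Q(·,ϖ₀) ≠ 0` on `[0,1]`, every honest
representation over the open cube `(0,1)ⁿ⁺¹` with integrand `P(z,ϖ₀)/Q(z₀,ϖ₀)` and vanishing integral is a
relation — in EVERY dimension, with no Tate condition and no identical vanishing needed (specialise the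
coefficients at `ϖ₀ ∈ K` and apply `cylinder_mem_relations_of_value_eq_zero`). [cite: KontsevichZagier2001, §1.2] -/
theorem tateFamilyKernel_cylinder :
    ∀ (n : ℕ) (P : MvPolynomial (Fin (n + 2)) ℚ) (Q : MvPolynomial (Fin 2) ℚ) (ϖ₀ : ℝ),
      IsAlgebraic ℚ ϖ₀ → (∀ t ∈ Set.Icc (0 : ℝ) 1, MvPolynomial.aeval ![t, ϖ₀] Q ≠ 0) →
      ∀ r : KZ.IntegralRep (n + 1), r.domain = Set.pi Set.univ (fun _ => Set.Ioo (0 : ℝ) 1) →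
        Set.EqOn r.integrand (fun z => MvPolynomial.aeval (Fin.snoc z ϖ₀ : Fin (n + 2) → ℝ) P /
          MvPolynomial.aeval ![z 0, ϖ₀] Q) r.domain →
        r.value = 0 → KZ.of r ∈ KZ.relations := by
  intro n P Q ϖ₀ hϖ₀ hQ r hd hi hv
  obtain ⟨P₀, hP₀⟩ := Fubini.exists_specLast P hϖ₀
  obtain ⟨q₀, hq₀⟩ := Fubini.exists_specParam Q hϖ₀
  refine cylinder_mem_relations_of_value_eq_zero n P₀ q₀ r (fun t ht => ?_) hd (fun z hz => ?_) hv
  · rw [hq₀ t]; exact hQ t ht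
  · rw [hi hz]
    show _ = MvPolynomial.aeval z P₀ / Polynomial.aeval (z 0) q₀
    rw [hP₀ z, hq₀ (z 0)]

/-- **The crux `TateFamilyKernel` (stmt-KontsevichZagierPeriods-9130) for families with a one-variable
denominator, in every dimension.** Literally the hypotheses of `TateFamilyKernel` in dimension `n + 1` — except
that the Tate-corner condition is not even needed — plus the hypothesis that the denominator `Q` involves only
`z₀` and `ϖ` (`Q(z,ϖ) = Q₁(z₀,ϖ)`): the fibre at every real-algebraic `ϖ₀ ∈ (0,ε)` is a relation.
[cite: KontsevichZagier2001, §1.2] -/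
theorem tateFamilyKernel_of_cylinderDenominator :
    ∀ (n : ℕ) (P Q : MvPolynomial (Fin (n + 2)) ℚ) (Q₁ : MvPolynomial (Fin 2) ℚ) (ε : ℝ), 0 < ε →
      (∀ (z : Fin (n + 1) → ℝ) (ϖ : ℝ), MvPolynomial.aeval (Fin.snoc z ϖ : Fin (n + 2) → ℝ) Q =
        MvPolynomial.aeval ![z 0, ϖ] Q₁) →
      (∀ (z : Fin (n + 1) → ℝ) (ϖ : ℝ), (∀ i, z i ∈ Set.Icc (0 : ℝ) 1) → ϖ ∈ Set.Ioo 0 ε →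
        MvPolynomial.aeval (Fin.snoc z ϖ : Fin (n + 2) → ℝ) Q ≠ 0) →
      (∀ ϖ ∈ Set.Ioo (0 : ℝ) ε, ∫ z in Set.pi Set.univ (fun _ : Fin (n + 1) => Set.Ioo (0 : ℝ) 1),
        MvPolynomial.aeval (Fin.snoc z ϖ : Fin (n + 2) → ℝ) P /
          MvPolynomial.aeval (Fin.snoc z ϖ : Fin (n + 2) → ℝ) Q = 0) →
      ∀ ϖ₀ : ℝ, IsAlgebraic ℚ ϖ₀ → ϖ₀ ∈ Set.Ioo 0 ε → ∀ r : KZ.IntegralRep (n + 1),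
        r.domain = Set.pi Set.univ (fun _ : Fin (n + 1) => Set.Ioo (0 : ℝ) 1) →
        Set.EqOn r.integrand (fun z => MvPolynomial.aeval (Fin.snoc z ϖ₀ : Fin (n + 2) → ℝ) P /
          MvPolynomial.aeval (Fin.snoc z ϖ₀ : Fin (n + 2) → ℝ) Q) r.domain →
        KZ.of r ∈ KZ.relations := by
  intro n P Q Q₁ ε _ hQ₁ hA hV ϖ₀ hϖ₀ hϖ₀ε r hd hi
  refine tateFamilyKernel_cylinder n P Q₁ ϖ₀ hϖ₀ (fun t ht => ?_) r hd (fun z hz => ?_) ?_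
  · have h := hA (fun _ => t) ϖ₀ (fun _ => ht) hϖ₀ε
    rwa [hQ₁] at h
  · rw [hi hz]
    show _ = _ / MvPolynomial.aeval ![z 0, ϖ₀] Q₁
    rw [← hQ₁ z ϖ₀]
  · rw [KZ.IntegralRep.value, setIntegral_congr_fun (KZ.IntegralRep.measurableSet_domain_holds r) hi, hd]
    exact hV ϖ₀ hϖ₀ε

end Summit.KontsevichZagierPeriods.InverseLandau

end
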